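import Literature.Geometry.Symplectic.SteinTwoHandles
import Literature.Geometry.Symplectic.SteinDomainDiffeomorph
import Literature.Topology.FourManifolds.HandleAttachingMapsUniqueness
import Literature.Topology.FourManifolds.HandleAttachingMapsExistence
import HarnessLib

/-!
# Eliashberg's theorem, part II (E2): the transport step, the no-handle case, and the
# reduction to one Stein model per attachment

Topic `Literature/Geometry/Symplectic`; proofs file below `SteinTwoHandles.lean`, whose single
named fact `Gompf1998_thm13_twoHandles` (**E2**: Gompf 1998, Thm. 1.3 (b)–(c) = Akbulut–Matveyev
1998, Thm. 2 (2) and §3, attributed by both to Eliashberg 1990) says: for a compact Stein `(W, S)`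
and an abstract manifold `P` which *is* `W` with finitely many 2-handles attached along attaching
maps `h̄ᵢ` (`HandleAttachingMap.IsMultiAttachment h (𝓡∂ 4) P`) whose attaching circles are
Legendrian of twisting `-1` ("framing `tb - 1`"), `P` admits a Stein structure.  The printed
proof (Gompf, loc. cit.: *"Eliashberg proves this theorem by explicit holomorphic gluing"*)
constructs ONE complex model of the attachment and is silent about the last, formal, step —
identifying that model with an arbitrary abstract attachment `P` — which in the tree is a
genuine obligation because `IsMultiAttachment` is a relational predicate.  This file discharges
exactly that step and what follows from it alone; the holomorphic gluing itself (items (i)–(iii)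
of the review in the module docstring of `SteinTwoHandles.lean`) is not touched and E2 remains a
named fact.

## Contents (all proved)

* `isSteinDomain_of_isMultiAttachment_of_isSteinDomain` — **transport step**: if one
  multi-attachment `P₀` along the `h̄ᵢ` is a Stein domain, every multi-attachment `P` along the
  `h̄ᵢ` is (uniqueness of multi-attachments up to diffeomorphism,
  `HandleAttachingMap.IsMultiAttachment.nonempty_diffeomorph`, `HandleAttachingMapsUniqueness.lean`,
  and invariance of `IsSteinDomain` under diffeomorphism, `IsSteinDomain.of_diffeomorph`,
  `SteinDomainDiffeomorph.lean`);
* `isSteinDomain_of_isMultiAttachment_of_isEmpty` — **E2 with no handles**: a multi-attachment of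
  the empty family of 2-handles to a Stein `W` is a Stein domain (`P ≅ W`;
  `SteinTwoHandles.lean` had to leave this vacuous form unasserted for want of transport);
* `Gompf1998_thm13_twoHandles_iff_exists_steinModel` — **E2 ⟺ its construction form**: E2 holds
  iff for every compact Stein `(W, S)` and every finite family of attaching maps with pairwise
  disjoint ranges, Legendrian attaching circles and twisting `-1` there EXISTS a compact
  multi-attachment which is a Stein domain ("⟸": transport step; "⟹": attachments exist,
  `HandleAttachingMap.exists_isMultiAttachment_holds`, `HandleAttachingMapsExistence.lean`, a
  compact manifold with boundary being second countable).  The right-hand side is what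
  Eliashberg's holomorphic gluing delivers; it is displayed inside the statement, not named (no new
  fact is introduced).

## References

* R. E. Gompf, *Handlebody construction of Stein surfaces*, Ann. of Math. 148 (1998), 619–693,
  Thm. 1.3 and the paragraph following it. [Gompf1998]
* S. Akbulut, R. Matveyev, *A convex decomposition theorem for 4-manifolds*, IMRN 1998, no. 7,
  371–381, Thm. 2 and §3. [AkbulutMatveyev1998]
* A. A. Kosinski, *Differential Manifolds* (1993), VI §1 (uniqueness of the smooth structure on an
  identification space), VI §6 (`M ∪ H^λ`). [Kosinski1993]
-/

noncomputable section

open scoped Manifold ContDiff Topology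
open Set Function

namespace Literature.Geometry.Symplectic

open Literature.Topology.FourManifolds

/-! ### The transport step and the no-handle case -/

section Transport

variable {W P : Type*} [TopologicalSpace W] [T2Space W] [ChartedSpace (EuclideanHalfSpace 4) W]
  [IsManifold (𝓡∂ 4) ∞ W] [CompactSpace W] [TopologicalSpace P]
  [ChartedSpace (EuclideanHalfSpace 4) P] [IsManifold (𝓡∂ 4) ∞ P] [CompactSpace P]

omit [IsManifold (𝓡∂ 4) ∞ W] [CompactSpace W] in
/-- **The transport step of Eliashberg's theorem.**  If some manifold `P₀` which is `W` with
2-handles attached along the `h̄ᵢ` is a Stein domain, then so is every manifold `P` which is `W`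
with 2-handles attached along the `h̄ᵢ`: two multi-attachments along the same attaching maps are
diffeomorphic (`HandleAttachingMap.IsMultiAttachment.nonempty_diffeomorph`, Kosinski VI §1) and
Stein structures pull back along diffeomorphisms (`IsSteinDomain.of_diffeomorph`).
[cite: Kosinski1993, Ch. VI §1, proof of Thm (1.1)] -/
theorem isSteinDomain_of_isMultiAttachment_of_isSteinDomain {ι : Type*} [Finite ι]
    {h : ι → HandleAttachingMap 3 2 W} {P₀ : Type*} [TopologicalSpace P₀]
    [ChartedSpace (EuclideanHalfSpace 4) P₀] [IsManifold (𝓡∂ 4) ∞ P₀] [CompactSpace P₀]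
    (hP₀ : HandleAttachingMap.IsMultiAttachment h (𝓡∂ 4) P₀) (hS₀ : IsSteinDomain P₀)
    (hP : HandleAttachingMap.IsMultiAttachment h (𝓡∂ 4) P) : IsSteinDomain P := by
  obtain ⟨e⟩ := hP.nonempty_diffeomorph hP₀
  exact IsSteinDomain.of_diffeomorph e hS₀

/-- **Eliashberg's theorem with no 2-handles.**  A manifold `P` which is a compact Stein `W`
with an *empty* family of 2-handles attached is a Stein domain: `P ≅ W`
(`HandleAttachingMap.IsMultiAttachment.nonempty_diffeomorph_of_isEmpty`) and the Stein structure
of `W` is transported.  This is the vacuous form of `Gompf1998_thm13_twoHandles` (index type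
empty; the Legendrian and framing hypotheses are then void and omitted). [folklore] -/
theorem isSteinDomain_of_isMultiAttachment_of_isEmpty {ι : Type*} [Finite ι] [IsEmpty ι]
    (S : SteinStructure W) {h : ι → HandleAttachingMap 3 2 W}
    (hP : HandleAttachingMap.IsMultiAttachment h (𝓡∂ 4) P) : IsSteinDomain P := by
  obtain ⟨e⟩ := hP.nonempty_diffeomorph_of_isEmpty
  exact IsSteinDomain.of_diffeomorph e ⟨S⟩

end Transport

/-! ### E2 is equivalent to its construction form -/

/-- **E2 ⟺ "every Legendrian `tb - 1` attachment datum has one Stein model".**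
`Gompf1998_thm13_twoHandles` (for every abstract multi-attachment `P`: `P` is a Stein domain)
holds if and only if, for every compact Stein `(W, S)` and every finite family of attaching maps
of 2-handles with pairwise disjoint ranges whose attaching circles are Legendrian of twisting
`-1`, there *exists* a compact multi-attachment `P₀` along the family which is a Stein domain —
the form in which Eliashberg's holomorphic gluing (Gompf 1998, paragraph after Thm. 1.3) produces
the result.  "⟸" is the transport step
(`isSteinDomain_of_isMultiAttachment_of_isSteinDomain`); "⟹" uses that multi-attachments exist
(`HandleAttachingMap.exists_isMultiAttachment_holds`; a compact manifold with boundary is second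
countable, Mathlib's `ChartedSpace.secondCountable_of_sigmaCompact`) and are compact for compact
`W`. [cite: Gompf1998, Thm. 1.3] -/
theorem Gompf1998_thm13_twoHandles_iff_exists_steinModel :
    Gompf1998_thm13_twoHandles ↔
      ∀ (W : Type) [TopologicalSpace W] [T2Space W] [ChartedSpace (EuclideanHalfSpace 4) W]
        [IsManifold (𝓡∂ 4) ∞ W] [CompactSpace W] (S : SteinStructure W) (ι : Type) [Finite ι]
        (h : ι → HandleAttachingMap 3 2 W),
        (Pairwise fun i j => Disjoint (range (h i).toFun) (range (h j).toFun)) →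
        (∀ i, IsLegendrianKnot S.J (h i).attachingCircle) →
        (∀ i, S.twisting (h i).attachingCircle (h i).attachingFraming = -1) →
        ∃ (P₀ : Type) (_ : TopologicalSpace P₀) (_ : ChartedSpace (EuclideanHalfSpace 4) P₀)
          (_ : IsManifold (𝓡∂ 4) ∞ P₀) (_ : CompactSpace P₀),
          HandleAttachingMap.IsMultiAttachment h (𝓡∂ 4) P₀ ∧ IsSteinDomain P₀ := by
  constructor
  · intro hE W _ _ _ _ _ S ι _ h hdisj hLeg htw
    haveI : SecondCountableTopology (EuclideanHalfSpace 4) :=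
      TopologicalSpace.Subtype.secondCountableTopology _
    haveI : SecondCountableTopology W :=
      ChartedSpace.secondCountable_of_sigmaCompact (EuclideanHalfSpace 4) W
    obtain ⟨P₀, _, _, _, -, -, hC, hP₀⟩ :=
      HandleAttachingMap.exists_isMultiAttachment_holds 3 2 W ι h hdisj
    haveI : CompactSpace P₀ := hC inferInstance
    exact ⟨P₀, _, _, _, inferInstance, hP₀, hE W P₀ S ι h hP₀ hLeg htw⟩
  · intro H W P _ _ _ _ _ _ _ _ _ S ι _ h hP hLeg htw
    obtain ⟨P₀, _, _, _, _, hP₀, hS₀⟩ := H W S ι h hP.1 hLeg htw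
    exact isSteinDomain_of_isMultiAttachment_of_isSteinDomain hP₀ hS₀ hP

end Literature.Geometry.Symplectic

end
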